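import Literature.AlgebraicGeometry.Resolution.InseparableLocalUniformizationHeightStepTrustBase
import Literature.AlgebraicGeometry.Resolution.DecompletionRoof
import HarnessLib

/-!
# Temkin 2013, Thm. 1.3.2: the trust base is ONE leaf (the smooth-fibre case of Thm. 3.3.1)

Topic: `Literature/AlgebraicGeometry/Resolution`. M. Temkin, *Inseparable local uniformization*,
J. Algebra 373 (2013) 65–119 = arXiv:0804.1554v3. With the decompletion lemma (Lemma 3.3.2,
corrected rendering `Temkin2013_Lemma332_nft`) now PROVED (`Temkin2013_Lemma332_nft_holds`,
`DecompletionRoof.lean`, closing the algebraic proof of the series `Decompletion*.lean`), the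
two-leaf reductions of `InseparableLocalUniformizationHeightStepTrustBase.lean` specialize: the
named facts `Temkin2013HeightStep`, `Temkin2013Relative` (Thm. 1.3.2, corrected relative form)
and `Temkin2013` (Thm. 1.3.2, weak form) all follow from the SINGLE remaining named fact
`Temkin2013RelativeCurveSmoothFibre` (Thm. 3.3.1 for `k`-smooth generic fibres,
`InseparableLocalUniformizationCurvesStepOne.lean`).

* `Temkin2013HeightStep.of_smoothFibre'`, `Temkin2013Relative.of_smoothFibre`,
  `Temkin2013.of_smoothFibre` — PROVED (one-line specializations).

All statements are [folklore] glue; no named facts.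

## Sources

* M. Temkin, arXiv:0804.1554v3, Thm. 1.3.2, Thm. 3.3.1, Lemma 3.3.2, Thm. 4.1.1.
-/

namespace Literature.AlgebraicGeometry.Resolution

universe u

/-- **The height step from the smooth-fibre case of Thm. 3.3.1 alone** (Lemma 3.3.2 is proved).
[folklore] -/
theorem Temkin2013HeightStep.of_smoothFibre' (hsf : Temkin2013RelativeCurveSmoothFibre.{u}) :
    Temkin2013HeightStep.{u} :=
  Temkin2013HeightStep.of_smoothFibre_lemma332nft hsf Temkin2013_Lemma332_nft_holds

/-- **Thm. 1.3.2 (corrected relative form) from the smooth-fibre case of Thm. 3.3.1 alone**: the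
trust base of `Temkin2013Relative` is the single named fact `Temkin2013RelativeCurveSmoothFibre`.
[folklore] -/
theorem Temkin2013Relative.of_smoothFibre (hsf : Temkin2013RelativeCurveSmoothFibre.{u}) :
    Temkin2013Relative.{u} :=
  Temkin2013Relative.of_smoothFibre_lemma332nft hsf Temkin2013_Lemma332_nft_holds

/-- **Thm. 1.3.2 (weak form) from the smooth-fibre case of Thm. 3.3.1 alone.** [folklore] -/
theorem Temkin2013.of_smoothFibre (hsf : Temkin2013RelativeCurveSmoothFibre.{u}) : Temkin2013.{u} :=
  Temkin2013.of_smoothFibre_lemma332nft hsf Temkin2013_Lemma332_nft_holds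

end Literature.AlgebraicGeometry.Resolution
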